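import Literature.NumberTheory.EllipticCurves.DeShalit1987.KatzMeasurePointTransport
import Literature.NumberTheory.GaloisRepresentations.FrobeniusDensity
import Literature.NumberTheory.Automorphic.ChebotarevArtinRepHolds
import Literature.NumberTheory.GaloisRepresentations.WeilLAdicCharacterProofs
import Literature.NumberTheory.GaloisRepresentations.HeckeCharacterCofiniteProofs
import Literature.NumberTheory.EllipticCurves.GoodReductionUnramifiedProofs
import HarnessLib

/-!
# `p`-adic avatars are RIGID and MULTIPLICATIVE: a framed Galois representation is determined by
# its Frobenii off a finite set (Chebotarev), an avatar of a Hecke character is unique, and the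
# twist of avatars is the avatar of the product with NO ramification hypothesis
# (width brick B11d-i, road α: the avatar of `ρ = θK·(ψ∘c)⁻¹` in the v10 frame)

Cell `bsd-print-cf2`, seat `bsd-line-cf2-p1-w4` g7, crux `stmt-BirchSwinnertonDyer-20368`
`PrintCf2.SplitBadTwoRankOneOfFacts`.  Theses-free; `--supports` the crux.  The v10 frame (and the
instantiation of S3a in v9.1) evaluates the two-variable measure at the avatar `r` of
`ρ := θK·λ`, `λ = (ψ∘c)⁻¹`, `θK` the quadratic Hecke character of the sign of `λ`'s avatar (files
`…QuadraticPart*`).  The tree's product rule `IsPAdicAvatarOf.mul_twist` (-w5) needs one factor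
UNRAMIFIED AWAY FROM `p` — false here: `θK` and `λ` are both ramified at the primes above `7d` while
`θK·λ` is not (that is the point of the sign twist).  The predicate `IsPAdicAvatarOf ι φ r` only
constrains `r` at places where `φ` is unramified, so at such places nothing can be read off the two
factors; the way out is RIGIDITY: `r ⊗ det e` and Weil's avatar of `ηρ` agree at almost all Frobenii,
hence everywhere by the density of Frobenius elements (Chebotarev, PROVED in the tree:
`Automorphic.chebotarev_artinRep_holds`, `absoluteGaloisGroup.frobenius_dense`).

* §1 (any number field, any Hausdorff topological coefficient ring, any rank)
  **`FramedGaloisRep.eq_of_eventually_frobenius_eq`**: two framed representations that agree on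
  every arithmetic Frobenius above all but finitely many places are EQUAL (closed equaliser ⊇ dense
  Frobenius set); rank-one entry form `eq_of_eventually_entry_eq`.
* §2 (any `p`) **`isPAdicAvatarOf_unique`**: two avatars of the same Hecke character coincide
  (places above `p` are finitely many, `HeightOneSpectrum.finite_setOf_natCast_mem`; ramification is
  finite, `HeckeCharacter.isUnramifiedAt_cofinite_holds`); `isPAdicAvatarOf_of_eventually` (an `r` with
  the avatar property at almost all places IS an avatar, when the character is algebraic — Weil's
  avatar `HeckeCharacter.IsAlgebraic.exists_lAdic` + §1).
* §3 **`isPAdicAvatarOf_mul_twist`**: `IsPAdicAvatarOf ι ρ r → IsPAdicAvatarOf ι η e →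
  (η * ρ).IsAlgebraic → IsPAdicAvatarOf ι (η * ρ) (FramedRep.twist r (detChar e))` — no ramification
  hypothesis (the agreement off the finite bad set is the computation of -w5's `mul_twist`).

HONEST FRAMING: plumbing over the tree's Chebotarev density and Weil's `ℓ`-adic characters; closes
nothing; beyond-print theorem: no (Serre 1968 Ch. I §2.3 "a semisimple `ℓ`-adic representation is
determined by its Frobenii").  BSD is not proved by any of this.

References: [SerreAbelianLadic1968] Ch. I §2.2–2.3, Ch. II §2.7; [DeligneSerreASENS1974] Lemme 3.2;
[TateGCFT1967] §2.4; [CastellaHsieh2018] §3.3.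
-/

-- the summit namespace `Summit.BirchSwinnertonDyer.BirchSwinnertonDyer` repeats the problem name by design (D-0017)
set_option linter.dupNamespace false
set_option autoImplicit false

noncomputable section

open scoped Classical

open Polynomial NumberField IsDedekindDomain Field Filter
  Literature.NumberTheory.EllipticCurves Literature.NumberTheory.GaloisRepresentations

namespace Summit.BirchSwinnertonDyer.BirchSwinnertonDyer.Theorems.PrintCf2.AvatarRigidity

/-! ## §1 A framed Galois representation is determined by its Frobenii off a finite set -/

section Rigidity

variable {K : Type} [Field K] [NumberField K] {A : Type*} [CommRing A] [TopologicalSpace A]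
  [T2Space A] {n : ℕ}

/-- **Rigidity (Chebotarev).**  Two continuous `r, r' : Γ_K → GL_n(A)` (`A` Hausdorff) which agree
on every arithmetic Frobenius above all but finitely many finite places of `K` are equal: the
equaliser `{σ : r σ = r' σ}` is closed and contains the set of such Frobenii, which is dense
(`absoluteGaloisGroup.frobenius_dense`, from the tree's Chebotarev theorem
`Automorphic.chebotarev_artinRep_holds`). [cite: SerreAbelianLadic1968, Ch. I §2.2 Cor. 2 (a) and §2.3] -/
theorem eq_of_eventually_frobenius_eq (r r' : FramedGaloisRep K A n)
    (h : ∀ᶠ v : HeightOneSpectrum (𝓞 K) in cofinite,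
      ∀ 𝔓 ∈ v.primesAbove, ∀ Φ : absoluteGaloisGroup K, IsArithFrobAt (𝓞 K) Φ 𝔓 → r Φ = r' Φ) :
    r = r' := by
  set S : Set (HeightOneSpectrum (𝓞 K)) := {v | ¬ ∀ 𝔓 ∈ v.primesAbove, ∀ Φ : absoluteGaloisGroup K,
    IsArithFrobAt (𝓞 K) Φ 𝔓 → r Φ = r' Φ} with hS
  have hSf : S.Finite := Filter.eventually_cofinite.1 h
  have hdense := absoluteGaloisGroup.frobenius_dense
    Literature.NumberTheory.Automorphic.chebotarev_artinRep_holds K S hSf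
  have hclosed : IsClosed {σ : absoluteGaloisGroup K |
      ((r σ : GL (Fin n) A) : Matrix (Fin n) (Fin n) A) = ((r' σ : GL (Fin n) A) : Matrix (Fin n) (Fin n) A)} :=
    isClosed_eq (Units.continuous_val.comp r.continuous) (Units.continuous_val.comp r'.continuous)
  have hsub : {σ : absoluteGaloisGroup K | ∃ v ∉ S, ∃ 𝔓 ∈ v.primesAbove, IsArithFrobAt (𝓞 K) σ 𝔓} ⊆
      {σ | ((r σ : GL (Fin n) A) : Matrix (Fin n) (Fin n) A) = ((r' σ : GL (Fin n) A) : Matrix _ _ A)} := by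
    rintro σ ⟨v, hv, 𝔓, h𝔓, hσ⟩
    have hv' : ∀ 𝔓 ∈ v.primesAbove, ∀ Φ : absoluteGaloisGroup K, IsArithFrobAt (𝓞 K) Φ 𝔓 → r Φ = r' Φ := by
      by_contra hc
      exact hv hc
    exact congrArg Units.val (hv' 𝔓 h𝔓 σ hσ)
  have huniv : Set.univ ⊆ {σ | ((r σ : GL (Fin n) A) : Matrix (Fin n) (Fin n) A) =
      ((r' σ : GL (Fin n) A) : Matrix (Fin n) (Fin n) A)} := by
    rw [← hdense.closure_eq]
    exact hclosed.closure_subset_iff.mpr hsub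
  exact ContinuousMonoidHom.ext fun σ ↦ Units.ext (huniv (Set.mem_univ σ))

/-- **Rank one, entry form**: two continuous characters `Γ_K → GL₁(A)` with the same entry at every
arithmetic Frobenius above all but finitely many places are equal. [cite: SerreAbelianLadic1968, Ch. I §2.3] -/
theorem eq_of_eventually_entry_eq (r r' : FramedGaloisRep K A 1)
    (h : ∀ᶠ v : HeightOneSpectrum (𝓞 K) in cofinite,
      ∀ 𝔓 ∈ v.primesAbove, ∀ Φ : absoluteGaloisGroup K, IsArithFrobAt (𝓞 K) Φ 𝔓 →
        (((r Φ : GL (Fin 1) A) : Matrix (Fin 1) (Fin 1) A) 0 0) =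
          (((r' Φ : GL (Fin 1) A) : Matrix (Fin 1) (Fin 1) A) 0 0)) :
    r = r' :=
  eq_of_eventually_frobenius_eq r r' (h.mono fun _ hv 𝔓 h𝔓 Φ hΦ ↦
    Matrix.GeneralLinearGroup.ext fun i j ↦ by
      rw [Subsingleton.elim i 0, Subsingleton.elim j 0]
      exact hv 𝔓 h𝔓 Φ hΦ)

end Rigidity

/-! ## §2 Avatars of Hecke characters are unique -/

section Avatar

variable {K : Type} [Field K] [NumberField K] {p : ℕ} [hp : Fact p.Prime] (ι : PadicAlgCl p ≃+* ℂ)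

/-- The places `v ∤ p` at which a Hecke character `φ` is unramified form a cofinite set.
[cite: TateThesis1967, Lemma 3.2.1] -/
theorem eventually_notMem_and_isUnramifiedAt (φ : HeckeCharacter K) :
    ∀ᶠ v : HeightOneSpectrum (𝓞 K) in cofinite, ((p : ℕ) : 𝓞 K) ∉ v.asIdeal ∧ φ.IsUnramifiedAt v :=
  (Set.Finite.eventually_cofinite_notMem
    (IsDedekindDomain.HeightOneSpectrum.finite_setOf_natCast_mem (R := 𝓞 K) hp.out.ne_zero)).and
    (HeckeCharacter.isUnramifiedAt_cofinite_holds φ)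

/-- At a place where `IsPAdicAvatarOf` speaks, the Frobenius entries are `ι⁻¹(φ(ϖ_v))⁻¹`. [cite: CastellaHsieh2018, §3.3] -/
theorem entry_eq_of_isPAdicAvatarOf {φ : HeckeCharacter K} {r : FramedGaloisRep K (PadicAlgCl p) 1}
    (hr : IsPAdicAvatarOf ι φ r) {v : HeightOneSpectrum (𝓞 K)} (hv : ((p : ℕ) : 𝓞 K) ∉ v.asIdeal)
    (hφ : φ.IsUnramifiedAt v) :
    ∀ 𝔓 ∈ v.primesAbove, ∀ Φ : absoluteGaloisGroup K, IsArithFrobAt (𝓞 K) Φ 𝔓 →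
      (((r Φ : GL (Fin 1) (PadicAlgCl p)) : Matrix (Fin 1) (Fin 1) (PadicAlgCl p)) 0 0) =
        (ι.symm (φ.valueAtUniformizer v))⁻¹ :=
  (FramedGaloisRep.hasFrobCharpolyAt_iff_of_rank_one r v _).mp (hr v hv hφ).2

/-- **Avatars are unique**: two `p`-adic avatars of the same Hecke character are equal (they agree at
every arithmetic Frobenius above the cofinitely many `v ∤ p` where the character is unramified;
§1). [cite: SerreAbelianLadic1968, Ch. I §2.3, Ch. II §2.7] -/
theorem isPAdicAvatarOf_unique {φ : HeckeCharacter K} {r r' : FramedGaloisRep K (PadicAlgCl p) 1}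
    (hr : IsPAdicAvatarOf ι φ r) (hr' : IsPAdicAvatarOf ι φ r') : r = r' :=
  eq_of_eventually_entry_eq r r' ((eventually_notMem_and_isUnramifiedAt (p := p) φ).mono
    fun v hv 𝔓 h𝔓 Φ hΦ ↦ by
      rw [entry_eq_of_isPAdicAvatarOf ι hr hv.1 hv.2 𝔓 h𝔓 Φ hΦ,
        entry_eq_of_isPAdicAvatarOf ι hr' hv.1 hv.2 𝔓 h𝔓 Φ hΦ])

/-- **Weil's avatar in `IsPAdicAvatarOf` form**: an algebraic Hecke character has a `p`-adic avatar
(the tree's `HeckeCharacter.IsAlgebraic.exists_lAdic`). [cite: Weil1956, §1–§2]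
[cite: SerreAbelianLadic1968, Ch. II §2.7] -/
theorem exists_isPAdicAvatarOf {φ : HeckeCharacter K} (hφ : φ.IsAlgebraic) :
    ∃ r : FramedGaloisRep K (PadicAlgCl p) 1, IsPAdicAvatarOf ι φ r := by
  obtain ⟨r, hr⟩ := hφ.exists_lAdic ι
  refine ⟨r, fun v hv hu ↦ ⟨(hr v hv hu).1, ?_⟩⟩
  have h := (hr v hv hu).2
  rwa [map_inv₀] at h

/-- **An `r` with the avatar property at ALMOST ALL places is an avatar** (for an algebraic character:
it agrees with Weil's avatar at almost all Frobenii, hence equals it, §1). [cite: SerreAbelianLadic1968, Ch. I §2.3] -/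
theorem isPAdicAvatarOf_of_eventually {φ : HeckeCharacter K} (hφ : φ.IsAlgebraic)
    {r : FramedGaloisRep K (PadicAlgCl p) 1}
    (h : ∀ᶠ v : HeightOneSpectrum (𝓞 K) in cofinite, ((p : ℕ) : 𝓞 K) ∉ v.asIdeal → φ.IsUnramifiedAt v →
      ∀ 𝔓 ∈ v.primesAbove, ∀ Φ : absoluteGaloisGroup K, IsArithFrobAt (𝓞 K) Φ 𝔓 →
        (((r Φ : GL (Fin 1) (PadicAlgCl p)) : Matrix (Fin 1) (Fin 1) (PadicAlgCl p)) 0 0) =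
          (ι.symm (φ.valueAtUniformizer v))⁻¹) :
    IsPAdicAvatarOf ι φ r := by
  obtain ⟨r₁, hr₁⟩ := exists_isPAdicAvatarOf ι hφ
  have heq : r = r₁ :=
    eq_of_eventually_entry_eq r r₁ ((h.and (eventually_notMem_and_isUnramifiedAt (p := p) φ)).mono
      fun v hv 𝔓 h𝔓 Φ hΦ ↦ by
        rw [hv.1 hv.2.1 hv.2.2 𝔓 h𝔓 Φ hΦ, entry_eq_of_isPAdicAvatarOf ι hr₁ hv.2.1 hv.2.2 𝔓 h𝔓 Φ hΦ])
  rw [heq]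
  exact hr₁

/-! ## §3 Products: the twist of avatars is the avatar of the product -/

omit [NumberField K] in
/-- The `(0,0)` entry of a twist `r ⊗ χ` is `χ(σ) · r(σ)₀₀`. [folklore] -/
theorem entry_twist (r : FramedGaloisRep K (PadicAlgCl p) 1)
    (χ : absoluteGaloisGroup K →ₜ* (PadicAlgCl p)ˣ) (σ : absoluteGaloisGroup K) :
    (((FramedRep.twist r χ σ : GL (Fin 1) (PadicAlgCl p)) : Matrix (Fin 1) (Fin 1) (PadicAlgCl p)) 0 0) =
      ((χ σ : (PadicAlgCl p)ˣ) : PadicAlgCl p) *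
        (((r σ : GL (Fin 1) (PadicAlgCl p)) : Matrix (Fin 1) (Fin 1) (PadicAlgCl p)) 0 0) := by
  rw [FramedRep.coe_twist_apply, Matrix.smul_apply, smul_eq_mul]

omit [NumberField K] in
/-- The determinant character of a rank-one `e` at `σ` is its entry. [folklore] -/
theorem coe_detChar_eq_entry (e : FramedGaloisRep K (PadicAlgCl p) 1) (σ : absoluteGaloisGroup K) :
    ((detChar e σ : (PadicAlgCl p)ˣ) : PadicAlgCl p) =
      (((e σ : GL (Fin 1) (PadicAlgCl p)) : Matrix (Fin 1) (Fin 1) (PadicAlgCl p)) 0 0) := by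
  rw [detChar_apply, Matrix.GeneralLinearGroup.val_det_apply, Matrix.det_fin_one]

/-- **The twist of avatars is the avatar of the product, with no ramification hypothesis** (for an
algebraic product): `IsPAdicAvatarOf ι ρ r → IsPAdicAvatarOf ι η e → (η * ρ).IsAlgebraic →
IsPAdicAvatarOf ι (η * ρ) (FramedRep.twist r (detChar e))`.  At the cofinitely many `v ∤ p` where `ρ`
and `η` are both unramified the twist has Frobenius entry `ι⁻¹(η(ϖ_v))⁻¹ · ι⁻¹(ρ(ϖ_v))⁻¹ =
ι⁻¹((ηρ)(ϖ_v))⁻¹`; by §2 this almost-everywhere avatar property suffices.  (The tree's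
`IsPAdicAvatarOf.mul_twist` is the case `η` unramified away from `p`.)
[cite: SerreAbelianLadic1968, Ch. II §2.7] [cite: CastellaHsieh2018, §3.3] -/
theorem isPAdicAvatarOf_mul_twist {ρ η : HeckeCharacter K} {r e : FramedGaloisRep K (PadicAlgCl p) 1}
    (hr : IsPAdicAvatarOf ι ρ r) (he : IsPAdicAvatarOf ι η e) (hηρ : (η * ρ).IsAlgebraic) :
    IsPAdicAvatarOf ι (η * ρ) (FramedRep.twist r (detChar e)) := by
  refine isPAdicAvatarOf_of_eventually ι hηρ
    (((eventually_notMem_and_isUnramifiedAt (p := p) ρ).and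
      (eventually_notMem_and_isUnramifiedAt (p := p) η)).mono fun v hv hvp _ 𝔓 h𝔓 Φ hΦ ↦ ?_)
  obtain ⟨⟨-, hρ⟩, ⟨-, hη⟩⟩ := hv
  rw [entry_twist, coe_detChar_eq_entry, entry_eq_of_isPAdicAvatarOf ι hr hvp hρ 𝔓 h𝔓 Φ hΦ,
    entry_eq_of_isPAdicAvatarOf ι he hvp hη 𝔓 h𝔓 Φ hΦ, HeckeCharacter.valueAtUniformizer_mul',
    map_mul, mul_inv]

/-- **Symmetric form**: `IsPAdicAvatarOf ι (ρ * η) (FramedRep.twist r (detChar e))`. [cite: SerreAbelianLadic1968, Ch. II §2.7] -/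
theorem isPAdicAvatarOf_mul_twist' {ρ η : HeckeCharacter K} {r e : FramedGaloisRep K (PadicAlgCl p) 1}
    (hr : IsPAdicAvatarOf ι ρ r) (he : IsPAdicAvatarOf ι η e) (hρη : (ρ * η).IsAlgebraic) :
    IsPAdicAvatarOf ι (ρ * η) (FramedRep.twist r (detChar e)) := by
  rw [mul_comm] at hρη ⊢
  exact isPAdicAvatarOf_mul_twist ι hr he hρη

end Avatar

end Summit.BirchSwinnertonDyer.BirchSwinnertonDyer.Theorems.PrintCf2.AvatarRigidity

end
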